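import Summits.CriticalPhenomena.PercolationContinuityZ3.Theorems.PercNearOneGluingNoHeavyLowerTailMajorityGluingCOneStar
import HarnessLib

/-!
# (C1*) reduced to one hypothesis-free bond inequality — the parity step (L**)
# (lane prim-rate, constants-miner 1, gen 4 — `prim-rate-mine-1/CANDIDATES.md` §GEN-4 R23; continues `…MajorityGluingCOneStar.lean`)

Support file for the closed crux `NoHeavyLowerTail` (stmt-CriticalPhenomena-4575; `--supports … --as helper`).

With the atoms `A,a,B,b,C,c,D,d = p₀₀₀,…,p₁₁₁` of the cut-indicator law of three relays `v₁,v₂,v₃` w.r.t. a hub `a₀` (index order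
`(v₁,v₂,v₃)`, `1` = cut; lower case = `v₃` cut), the mined exchange inequality (C1*) `bc ≤ BC` of row M1-C1STAR is equivalent to
`μ(v₃ cut | v₁ joined, v₂ cut) + μ(v₃ cut | v₁ cut, v₂ joined) ≤ 1`.  THIS FILE proves (`c1star_of_parityStep`, pure real arithmetic by an explicit
Farkas certificate `parityCertificate_identity`) that the two van den Berg–Kahn instances (V1) `bD ≤ Bd`, (V2) `cD ≤ Cd`, the cap `δ₃ ≤ 1/2`, the
orderings `δ₃ ≤ δ₁`, `δ₃ ≤ δ₂` AND the single implication «`BC < bc ⟹ AD < ad`» force (C1*); and the measure-level corollary `c1star_of_Lstar`.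
Consequently the open core of rows M1-C1STAR / M1-MAJ3 / the window cells `|A| = 6, 7` is the HYPOTHESIS-FREE bond statement
(L**) «`p₀₁₀p₁₀₀ < p₀₁₁p₁₀₁ ⟹ p₀₀₀p₁₁₀ < p₀₀₁p₁₁₁`» (if `v₃`'s cut-odds in the two disagreement states of `(v₁,v₂)` multiply to more than `1`,
so do its cut-odds in the two agreement states): 0 counterexamples in every census of the lane, violated by the hyperedge law of row M1-HYP — so
necessarily bond-specific (two-copy decision-tree territory, Gladkov–Zimin).  No definitions, no named facts, no sorries.
[cite: VandenbergKahn2001, Thm 1.1 (p. 123)]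
-/

noncomputable section

namespace Summit.CriticalPhenomena.PercolationContinuityZ3.Theorems

open MeasureTheory Set
open Literature.Probability.LatticeModels (prodBernoulli)
open Literature.Probability.Percolation
open scoped Classical

namespace HubOnly

variable {n : ℕ}

/-- The ring identity behind the Farkas certificate of `c1star_of_parityStep` (constants-miner 1, gen 4, CANDIDATES §GEN-4 R23). [folklore] -/
theorem parityCertificate_identity (A a B b C c D d s r : ℝ) :
    (1 + r) * ((a + b + c + d) - (A + B + C + D)) + (s + 1 - r) * (a + b - C - D) + (s * r + r - 1) * (a + c - B - D) =
      (1 + r) * ((1 + s) * a - A) + (1 + r) * (d - (1 + s) * D) + (2 + s) * ((b - r * B) + (r * c - C)) := by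
  ring

set_option maxHeartbeats 400000 in
/-- **REDUCTION OF (C1*) TO A HYPOTHESIS-FREE STEP (pure real arithmetic; CANDIDATES §GEN-4 R23).**  Eight nonnegative reals
(the atoms `A,a,B,b,C,c,D,d = p₀₀₀,p₀₀₁,p₀₁₀,p₀₁₁,p₁₀₀,p₁₀₁,p₁₁₀,p₁₁₁` of a three-relay cut law) satisfying (V1) `bD ≤ Bd`, (V2) `cD ≤ Cd`, the cap
`a+b+c+d ≤ A+B+C+D` (`δ₃ ≤ 1/2`), `a+b ≤ C+D` (`δ₃ ≤ δ₁`), `a+c ≤ B+D` (`δ₃ ≤ δ₂`) and the PARITY STEP «`BC < bc ⟹ AD < ad`» (the instance of the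
conjectural bond inequality (L**): if `v₃`'s cut-odds in the two disagreement states of `(v₁,v₂)` multiply to `> 1` then so do its cut-odds in the
two agreement states) obey (C1*) `bc ≤ BC`.  Proof: a Farkas certificate — for suitable `σ = 1+s ∈ (max(1, A/a, ·), d/D)` and `r ∈ [1/σ, σ]`,
`(1+r)·cap + (s+1−r)·(δ₁−δ₃) + (sr+r−1)·(δ₂−δ₃)` is a sum of positive block terms (`parityCertificate_identity`). [folklore] -/
theorem c1star_of_parityStep (A a B b C c D d : ℝ) (hA : 0 ≤ A) (ha : 0 ≤ a) (hB : 0 ≤ B) (hb : 0 ≤ b) (hC : 0 ≤ C)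
    (hc : 0 ≤ c) (hD : 0 ≤ D) (hd : 0 ≤ d)
    (V1 : b * D ≤ B * d) (V2 : c * D ≤ C * d)
    (cap : a + b + c + d ≤ A + B + C + D) (H1 : a + b ≤ C + D) (H2 : a + c ≤ B + D)
    (hL : B * C < b * c → A * D < a * d) :
    b * c ≤ B * C := by
  by_contra h
  have hΦ1 : B * C < b * c := lt_of_not_ge h
  have hΦ2 : A * D < a * d := hL hΦ1
  have hbpos : 0 < b := by
    rcases eq_or_lt_of_le hb with h0 | h0
    · rw [← h0, zero_mul] at hΦ1; exact absurd hΦ1 (not_lt.2 (mul_nonneg hB hC))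
    · exact h0
  have hcpos : 0 < c := by
    rcases eq_or_lt_of_le hc with h0 | h0
    · rw [← h0, mul_zero] at hΦ1; exact absurd hΦ1 (not_lt.2 (mul_nonneg hB hC))
    · exact h0
  have hapos : 0 < a := by
    rcases eq_or_lt_of_le ha with h0 | h0
    · rw [← h0, zero_mul] at hΦ2; exact absurd hΦ2 (not_lt.2 (mul_nonneg hA hD))
    · exact h0
  rcases eq_or_lt_of_le hD with hD0 | hDpos
  · have hb' : b ≤ C := by rw [← hD0] at H1; linarith
    have hc' : c ≤ B := by rw [← hD0] at H2; linarith
    nlinarith [mul_le_mul hb' hc' hc hC]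
  · -- d > D
    have hdD : D < d := by
      by_contra hle
      have hle' : d ≤ D := le_of_not_gt hle
      have h2 : d ^ 2 ≤ D ^ 2 := pow_le_pow_left₀ hd hle' 2
      have hprod : b * c * D ^ 2 ≤ B * C * d ^ 2 := by
        nlinarith [mul_le_mul V1 V2 (mul_nonneg hc hD) (mul_nonneg hB hd)]
      nlinarith [mul_le_mul_of_nonneg_left h2 (mul_nonneg hB hC), mul_pos hDpos hDpos]
    have hdpos : 0 < d := hDpos.trans hdD
    -- the ratios
    set q := d / D with hq
    have hq1 : 1 < q := by rw [hq, lt_div_iff₀ hDpos]; linarith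
    have hqA : A / a < q := by
      rw [hq, div_lt_div_iff₀ hapos hDpos]; linarith
    -- generic contradiction from a choice of σ = 1+s and r
    have key : ∀ σ r : ℝ, 1 ≤ σ → A / a < σ → σ < q → 1 / σ ≤ r → r ≤ σ → 0 ≤ (b - C) + r * (c - B) → False := by
      intro σ r hσ1 hσA hσq hr1 hr2 hblk
      have hσpos : 0 < σ := by linarith
      have hs1 : 0 ≤ (σ - 1) + 1 - r := by linarith
      have hs2 : 0 ≤ (σ - 1) * r + r - 1 := by
        have : 1 ≤ σ * r := by
          rw [div_le_iff₀ hσpos] at hr1; linarith [hr1]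
        nlinarith
      have hrpos : 0 < r := lt_of_lt_of_le (by positivity) hr1
      have ida := parityCertificate_identity A a B b C c D d (σ - 1) r
      have hcap' : (a + b + c + d) - (A + B + C + D) ≤ 0 := by linarith
      have hH1' : a + b - C - D ≤ 0 := by linarith
      have hH2' : a + c - B - D ≤ 0 := by linarith
      have hlhs : (1 + r) * ((a + b + c + d) - (A + B + C + D)) + ((σ - 1) + 1 - r) * (a + b - C - D) +
          ((σ - 1) * r + r - 1) * (a + c - B - D) ≤ 0 := by
        have t1 : (1 + r) * ((a + b + c + d) - (A + B + C + D)) ≤ 0 :=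
          mul_nonpos_of_nonneg_of_nonpos (by linarith) hcap'
        have t2 : ((σ - 1) + 1 - r) * (a + b - C - D) ≤ 0 := mul_nonpos_of_nonneg_of_nonpos hs1 hH1'
        have t3 : ((σ - 1) * r + r - 1) * (a + c - B - D) ≤ 0 := mul_nonpos_of_nonneg_of_nonpos hs2 hH2'
        linarith
      have hb1 : 0 < (1 + (σ - 1)) * a - A := by
        have : A < σ * a := by rwa [div_lt_iff₀ hapos] at hσA
        linarith
      have hb2 : 0 < d - (1 + (σ - 1)) * D := by
        have : σ * D < d := by
          have := hσq; rw [hq, lt_div_iff₀ hDpos] at this; linarith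
        linarith
      have hrhs : 0 < (1 + r) * ((1 + (σ - 1)) * a - A) + (1 + r) * (d - (1 + (σ - 1)) * D) +
          (2 + (σ - 1)) * ((b - r * B) + (r * c - C)) := by
        have t1 : 0 < (1 + r) * ((1 + (σ - 1)) * a - A) := mul_pos (by linarith) hb1
        have t2 : 0 < (1 + r) * (d - (1 + (σ - 1)) * D) := mul_pos (by linarith) hb2
        have t3 : 0 ≤ (2 + (σ - 1)) * ((b - r * B) + (r * c - C)) :=
          mul_nonneg (by linarith) (by linarith)
        linarith
      rw [ida] at hlhs
      linarith
    -- choose σ and r by cases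
    by_cases hbC : C < b
    · by_cases hcB : B ≤ c
      · -- case (I): r = 1
        set σ := (max 1 (A / a) + q) / 2 with hσ
        have hm : max 1 (A / a) < q := max_lt hq1 hqA
        refine key σ 1 ?_ ?_ ?_ ?_ ?_ ?_
        · have := le_max_left 1 (A / a); rw [hσ]; linarith
        · have := le_max_right 1 (A / a); rw [hσ]; linarith
        · rw [hσ]; linarith
        · have h1σ : 1 ≤ σ := by have := le_max_left 1 (A / a); rw [hσ]; linarith
          rw [div_le_iff₀ (by linarith)]; linarith
        · have := le_max_left 1 (A / a); rw [hσ]; linarith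
        · linarith
      · -- case (II): b > C, c < B: r = 1/σ with σ > (B - c)/(b - C)
        have hcB' : c < B := lt_of_not_ge hcB
        have hbC' : 0 < b - C := by linarith
        have hrat : (B - c) / (b - C) < q := by
          rw [hq, div_lt_div_iff₀ hbC' hDpos]
          -- d(b-C) - D(B-c) ≥ D(bc-BC)/C > 0  via V2 (c D ≤ C d)
          rcases eq_or_lt_of_le hC with hC0 | hCpos
          · -- C = 0: then b - C = b, need (B-c) D < d b; from V2 with C=0: c D ≤ 0 ⇒ impossible since c>0, D>0
            exfalso; rw [← hC0, zero_mul] at V2; nlinarith [mul_pos hcpos hDpos]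
          · nlinarith [mul_le_mul_of_nonneg_left V2 hbC'.le, mul_pos hDpos (sub_pos.2 hΦ1)]
        set σ := (max (max 1 (A / a)) ((B - c) / (b - C)) + q) / 2 with hσ
        have hm : max (max 1 (A / a)) ((B - c) / (b - C)) < q := max_lt (max_lt hq1 hqA) hrat
        have h1σ : 1 ≤ σ := by
          have := (le_max_left 1 (A / a)).trans (le_max_left (max 1 (A / a)) ((B - c) / (b - C))); rw [hσ]; linarith
        have hσpos : 0 < σ := by linarith
        refine key σ (1 / σ) h1σ ?_ ?_ le_rfl ?_ ?_
        · have := (le_max_right 1 (A / a)).trans (le_max_left (max 1 (A / a)) ((B - c) / (b - C))); rw [hσ]; linarith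
        · rw [hσ]; linarith
        · rw [div_le_iff₀ hσpos]; nlinarith
        · -- (b - C) + (1/σ)(c - B) ≥ 0 ⟸ σ (b - C) ≥ (B - c)
          have hσr : (B - c) / (b - C) < σ := by
            have := le_max_right (max 1 (A / a)) ((B - c) / (b - C)); rw [hσ]; linarith
          have h3 : B - c < σ * (b - C) := by rwa [div_lt_iff₀ hbC'] at hσr
          have e : (b - C) + 1 / σ * (c - B) = (σ * (b - C) - (B - c)) / σ := by field_simp; ring
          rw [e]; exact div_nonneg (by linarith) hσpos.le
    · -- case (III): b ≤ C, hence c > B (from bc > BC): r = σ with σ > (C - b)/(c - B)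
      have hbC' : b ≤ C := le_of_not_gt hbC
      have hcB : B < c := by
        by_contra hle
        have : c ≤ B := le_of_not_gt hle
        nlinarith [mul_le_mul hbC' this hc hC]
      have hcB' : 0 < c - B := by linarith
      have hrat : (C - b) / (c - B) < q := by
        rw [hq, div_lt_div_iff₀ hcB' hDpos]
        rcases eq_or_lt_of_le hB with hB0 | hBpos
        · exfalso; rw [← hB0, zero_mul] at V1; nlinarith [mul_pos hbpos hDpos]
        · nlinarith [mul_le_mul_of_nonneg_left V1 hcB'.le, mul_pos hDpos (sub_pos.2 hΦ1)]
      set σ := (max (max 1 (A / a)) ((C - b) / (c - B)) + q) / 2 with hσ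
      have h1σ : 1 ≤ σ := by
        have := (le_max_left 1 (A / a)).trans (le_max_left (max 1 (A / a)) ((C - b) / (c - B))); rw [hσ]; linarith
      have hσpos : 0 < σ := by linarith
      refine key σ σ h1σ ?_ ?_ ?_ le_rfl ?_
      · have := (le_max_right 1 (A / a)).trans (le_max_left (max 1 (A / a)) ((C - b) / (c - B))); rw [hσ]; linarith
      · have hm : max (max 1 (A / a)) ((C - b) / (c - B)) < q := max_lt (max_lt hq1 hqA) hrat
        rw [hσ]; linarith
      · rw [div_le_iff₀ hσpos]; nlinarith
      · have hσr : (C - b) / (c - B) < σ := by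
          have := le_max_right (max 1 (A / a)) ((C - b) / (c - B)); rw [hσ]; linarith
        have h3 : C - b < σ * (c - B) := by rwa [div_lt_iff₀ hcB'] at hσr
        linarith [h3]


/-- **(C1*) FROM THE PARITY STEP (L**) AT `(a₀; v₁, v₂, v₃)`** — the measure-level corollary: for Bernoulli bond percolation, the hypotheses of
row M1-C1STAR (`δ₃ ≤ δ₁`, `δ₃ ≤ δ₂`, `δ₃ ≤ 1/2`, `δᵢ = μ(a₀ ↮ vᵢ)`) together with the single hypothesis-free implication
«`p₀₁₀p₁₀₀ < p₀₁₁p₁₀₁ ⟹ p₀₀₀p₁₁₀ < p₀₀₁p₁₁₁`» give (C1*) `p₀₁₁p₁₀₁ ≤ p₁₀₀p₀₁₀`; (V1), (V2) are supplied by `vdBK_atoms`, `vdBK_atoms₂`.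
So the open core of rows M1-C1STAR / M1-MAJ3 / the window cells `|A| = 6, 7` is the bond inequality (L**) (CANDIDATES §GEN-4 R23; 0 violations in
every census, violated by the hypergraph law of row M1-HYP). [cite: VandenbergKahn2001, Thm 1.1 (p. 123)] -/
theorem c1star_of_Lstar (w : Sym2 (Fin n) → unitInterval) (a₀ v₁ v₂ v₃ : Fin n)
    (h31 : (prodBernoulli w).real (openConn a₀ v₃ : Set (BondConfig (Fin n)))ᶜ ≤ (prodBernoulli w).real (openConn a₀ v₁ : Set (BondConfig (Fin n)))ᶜ)
    (h32 : (prodBernoulli w).real (openConn a₀ v₃ : Set (BondConfig (Fin n)))ᶜ ≤ (prodBernoulli w).real (openConn a₀ v₂ : Set (BondConfig (Fin n)))ᶜ)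
    (hcap : (prodBernoulli w).real (openConn a₀ v₃ : Set (BondConfig (Fin n)))ᶜ ≤ 1 / 2)
    (hL : (prodBernoulli w).real (openConn a₀ v₁ ∩ (openConn a₀ v₂)ᶜ ∩ openConn a₀ v₃) *
        (prodBernoulli w).real ((openConn a₀ v₁)ᶜ ∩ openConn a₀ v₂ ∩ openConn a₀ v₃) <
      (prodBernoulli w).real (openConn a₀ v₁ ∩ (openConn a₀ v₂)ᶜ ∩ (openConn a₀ v₃)ᶜ) *
        (prodBernoulli w).real ((openConn a₀ v₁)ᶜ ∩ openConn a₀ v₂ ∩ (openConn a₀ v₃)ᶜ) →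
      (prodBernoulli w).real (openConn a₀ v₁ ∩ openConn a₀ v₂ ∩ openConn a₀ v₃) *
        (prodBernoulli w).real ((openConn a₀ v₁)ᶜ ∩ (openConn a₀ v₂)ᶜ ∩ openConn a₀ v₃) <
      (prodBernoulli w).real (openConn a₀ v₁ ∩ openConn a₀ v₂ ∩ (openConn a₀ v₃)ᶜ) *
        (prodBernoulli w).real ((openConn a₀ v₁)ᶜ ∩ (openConn a₀ v₂)ᶜ ∩ (openConn a₀ v₃)ᶜ)) :
    (prodBernoulli w).real (openConn a₀ v₁ ∩ (openConn a₀ v₂)ᶜ ∩ (openConn a₀ v₃)ᶜ) *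
        (prodBernoulli w).real ((openConn a₀ v₁)ᶜ ∩ openConn a₀ v₂ ∩ (openConn a₀ v₃)ᶜ) ≤
      (prodBernoulli w).real ((openConn a₀ v₁)ᶜ ∩ openConn a₀ v₂ ∩ openConn a₀ v₃) *
        (prodBernoulli w).real (openConn a₀ v₁ ∩ (openConn a₀ v₂)ᶜ ∩ openConn a₀ v₃) := by
  set μ := prodBernoulli w with hμ
  set J1 : Set (BondConfig (Fin n)) := openConn a₀ v₁ with hJ1
  set J2 : Set (BondConfig (Fin n)) := openConn a₀ v₂ with hJ2
  set J3 : Set (BondConfig (Fin n)) := openConn a₀ v₃ with hJ3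
  set A := μ.real (J1 ∩ J2 ∩ J3) with hA'
  set a := μ.real (J1 ∩ J2 ∩ J3ᶜ) with ha'
  set B := μ.real (J1 ∩ J2ᶜ ∩ J3) with hB'
  set b := μ.real (J1 ∩ J2ᶜ ∩ J3ᶜ) with hb'
  set C := μ.real (J1ᶜ ∩ J2 ∩ J3) with hC'
  set c := μ.real (J1ᶜ ∩ J2 ∩ J3ᶜ) with hc'
  set D := μ.real (J1ᶜ ∩ J2ᶜ ∩ J3) with hD'
  set d := μ.real (J1ᶜ ∩ J2ᶜ ∩ J3ᶜ) with hd'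
  have V1 : b * D ≤ B * d := vdBK_atoms w a₀ v₁ v₂ v₃
  have V2 : c * D ≤ C * d := vdBK_atoms₂ w a₀ v₁ v₂ v₃
  -- marginals in atoms
  have e3c : μ.real J3ᶜ = a + b + (c + d) := by
    rw [real_split w J3ᶜ J1, real_split w (J3ᶜ ∩ J1) J2, real_split w (J3ᶜ ∩ J1ᶜ) J2]
    have s1 : J3ᶜ ∩ J1 ∩ J2 = J1 ∩ J2 ∩ J3ᶜ := by ext ω; simp only [mem_inter_iff, mem_compl_iff]; tauto
    have s2 : J3ᶜ ∩ J1 ∩ J2ᶜ = J1 ∩ J2ᶜ ∩ J3ᶜ := by ext ω; simp only [mem_inter_iff, mem_compl_iff]; tauto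
    have s3 : J3ᶜ ∩ J1ᶜ ∩ J2 = J1ᶜ ∩ J2 ∩ J3ᶜ := by ext ω; simp only [mem_inter_iff, mem_compl_iff]; tauto
    have s4 : J3ᶜ ∩ J1ᶜ ∩ J2ᶜ = J1ᶜ ∩ J2ᶜ ∩ J3ᶜ := by ext ω; simp only [mem_inter_iff, mem_compl_iff]; tauto
    rw [s1, s2, s3, s4]
  have e3 : μ.real J3 = A + B + (C + D) := by
    rw [real_split w J3 J1, real_split w (J3 ∩ J1) J2, real_split w (J3 ∩ J1ᶜ) J2]
    have s1 : J3 ∩ J1 ∩ J2 = J1 ∩ J2 ∩ J3 := by ext ω; simp only [mem_inter_iff]; tauto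
    have s2 : J3 ∩ J1 ∩ J2ᶜ = J1 ∩ J2ᶜ ∩ J3 := by ext ω; simp only [mem_inter_iff, mem_compl_iff]; tauto
    have s3 : J3 ∩ J1ᶜ ∩ J2 = J1ᶜ ∩ J2 ∩ J3 := by ext ω; simp only [mem_inter_iff, mem_compl_iff]; tauto
    have s4 : J3 ∩ J1ᶜ ∩ J2ᶜ = J1ᶜ ∩ J2ᶜ ∩ J3 := by ext ω; simp only [mem_inter_iff, mem_compl_iff]; tauto
    rw [s1, s2, s3, s4]
  have e1c : μ.real J1ᶜ = C + c + (D + d) := by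
    rw [real_split w J1ᶜ J2, real_split w (J1ᶜ ∩ J2) J3, real_split w (J1ᶜ ∩ J2ᶜ) J3]
  have e2c : μ.real J2ᶜ = B + b + (D + d) := by
    rw [real_split w J2ᶜ J1, real_split w (J2ᶜ ∩ J1) J3, real_split w (J2ᶜ ∩ J1ᶜ) J3]
    have s1 : J2ᶜ ∩ J1 ∩ J3 = J1 ∩ J2ᶜ ∩ J3 := by ext ω; simp only [mem_inter_iff, mem_compl_iff]; tauto
    have s2 : J2ᶜ ∩ J1 ∩ J3ᶜ = J1 ∩ J2ᶜ ∩ J3ᶜ := by ext ω; simp only [mem_inter_iff, mem_compl_iff]; tauto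
    have s3 : J2ᶜ ∩ J1ᶜ ∩ J3 = J1ᶜ ∩ J2ᶜ ∩ J3 := by ext ω; simp only [mem_inter_iff, mem_compl_iff]; tauto
    have s4 : J2ᶜ ∩ J1ᶜ ∩ J3ᶜ = J1ᶜ ∩ J2ᶜ ∩ J3ᶜ := by ext ω; simp only [mem_inter_iff, mem_compl_iff]; tauto
    rw [s1, s2, s3, s4]
  have etot : μ.real J3 = 1 - μ.real J3ᶜ := by
    have := probReal_compl_eq_one_sub (μ := μ) (MeasurableSet.of_discrete : MeasurableSet J3)
    linarith
  have cap : a + b + c + d ≤ A + B + C + D := by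
    have : μ.real J3ᶜ ≤ μ.real J3 := by rw [etot]; linarith
    rw [e3c, e3] at this; linarith
  have H1 : a + b ≤ C + D := by have := h31; rw [e3c, e1c] at this; linarith
  have H2 : a + c ≤ B + D := by have := h32; rw [e3c, e2c] at this; linarith
  have hfin := c1star_of_parityStep A a B b C c D d measureReal_nonneg measureReal_nonneg measureReal_nonneg measureReal_nonneg
    measureReal_nonneg measureReal_nonneg measureReal_nonneg measureReal_nonneg V1 V2 cap H1 H2 hL
  linarith [hfin, mul_comm B C]

end HubOnly

end Summit.CriticalPhenomena.PercolationContinuityZ3.Theorems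

end
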